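import Literature.NumberTheory.EllipticCurves.SelmerLocalConditionUnramifiedTorsion
import Literature.NumberTheory.EllipticCurves.GaloisActionProofs
import HarnessLib

/-!
# `E(K_v)[n] = E[n]` when `Γ_{K_v}` fixes `E[n]`: `#E(K_v)[n] = n²`
# (McCallum 1991, §4: *"`λ` splits completely in `K(E_{p^M})`, hence `E(K_λ)_{p^M} = E_{p^M}`"*)

Topic `NumberTheory/EllipticCurves`. THEOREMS ONLY: no definition, no named fact, no `sorry`
(D-0026). Deliberate dot-notation extensions of Mathlib's `WeierstrassCurve` namespace.

For an elliptic curve `E = W` over a number field `K`, a finite place `v`, `n ≠ 0`, and a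
`K`-embedding `ι : K̄ → K̄_v` through which `Γ_{K_v}` acts on `E[n] = E(K̄)[n]`
(`resGalOfEmb ι : Γ_{K_v} → Γ_K`; for the chosen embedding this is `absGaloisRestrict K K_v`):
if every `σ ∈ Γ_{K_v}` fixes `E[n]`, then the `n`-torsion of Mathlib's group `E(K_v)` of
`K_v`-points has exactly `n²` elements —
`WeierstrassCurve.natCard_torsionPoints_adicCompletion_eq_sq_of_forall_smul_eq` (and the same for the
kernel of multiplication by `n : ℕ`, `…natCard_ker_nsmul_adicCompletion_eq_sq_of_forall_smul_eq`).
Proof: `n² = #E[n] = #E[n]^{Γ_{K_v}}` divides `#E(K_v)[n]` (Galois descent, tree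
`WeierstrassCurve.card_fixed_dvd_card_torsionPoints`), and `E(K_v)[n] ↪ E(K̄_v)[n]` has at most `n²`
elements (Silverman III.6.4(b), tree `WeierstrassCurve.card_torsionPoints_eq_sq_holds`).

This is the situation at a Kolyvagin prime `λ` of level `p^M` (McCallum 1991 §4; Gross 1991 §4
(4.1): *"the prime `λ` splits completely in the extension `K(E_p)/K` … `E(K_λ)_p = E_p`"*; tree
`absGaloisRestrict_smul_geomTorsion_eq_of_kolyvaginPrime_pow`), where it feeds the hypotheses
`#E(K_λ)[p] ≤ p²`, `#E(K_λ)[p^k] ≥ p^{2k}` of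
`WeierstrassCurve.natCard_ker_map_sub_smul_quotient_adicCompletion_eq`
(`LocalPointsPrimaryQuotientEigenparts.lean`, Jetchev 2008 §3.2 (2)).

## References
* [McCallumLMS1991] W. G. McCallum, *Kolyvagin's work on Shafarevich–Tate groups*, LMS LNS 153
  (1991), §4 (p. 300).
* [GrossLMS1991] B. H. Gross, *Kolyvagin's work on modular elliptic curves*, ibid., §4 (4.1).
* [SilvermanAEC2009] J. H. Silverman, *The Arithmetic of Elliptic Curves*, 2nd ed., Cor. III.6.4(b),
  VIII.§1.
-/

noncomputable section

open scoped Classical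

universe u

namespace WeierstrassCurve

open Literature.NumberTheory.EllipticCurves Literature.NumberTheory.GaloisRepresentations Field
open NumberField IsDedekindDomain

variable {K : Type u} [Field K] [NumberField K] (W : WeierstrassCurve K) [W.IsElliptic]

/-- **`#E(K_v)[n] = n²` when `Γ_{K_v}` fixes `E[n]`** (McCallum 1991, §4: *"`λ` splits completely
in `K(E_{p^M})`, hence `E(K_λ)_{p^M} = E_{p^M}`"*; Gross 1991, §4 (4.1)). For `W` elliptic over a
number field `K`, `v` a finite place, `n ≠ 0` and a `K`-embedding `ι : K̄ → K̄_v`: if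
`resGalOfEmb ι σ` fixes every point of `E[n] = E(K̄)[n]` for all `σ ∈ Γ_{K_v}`, then
`#E(K_v)[n] = n²`, `E(K_v)[n]` the `n`-torsion of Mathlib's `K_v`-points of `W ⊗ K_v`.
[cite: McCallumLMS1991, §4 (p. 300)] [cite: GrossLMS1991, §4 (4.1)]
[cite: SilvermanAEC2009, Cor. III.6.4(b) and VIII.§1] -/
theorem natCard_torsionPoints_adicCompletion_eq_sq_of_forall_smul_eq
    (v : HeightOneSpectrum (𝓞 K)) {n : ℕ} (hn : n ≠ 0)
    (ι : AlgebraicClosure K →ₐ[K] AlgebraicClosure (v.adicCompletion K))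
    (hfix : ∀ (σ : absoluteGaloisGroup (v.adicCompletion K)) (P : W.geomTorsion n),
      resGalOfEmb ι σ • P = P) :
    Nat.card (W.torsionPoints (v.adicCompletion K) n) = n ^ 2 := by
  haveI : CharZero (v.adicCompletion K) :=
    charZero_of_injective_algebraMap (algebraMap K (v.adicCompletion K)).injective
  -- `#E[n] = n²` over `K̄` and over `K̄_v`
  have hgeom : Nat.card (W.geomTorsion n) = n ^ 2 :=
    W.card_torsionPoints_eq_sq_holds (AlgebraicClosure K) (n := n) (by exact_mod_cast hn)
  have hloc : Nat.card (W.torsionPoints (AlgebraicClosure (v.adicCompletion K)) n) = n ^ 2 :=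
    W.card_torsionPoints_eq_sq_holds (AlgebraicClosure (v.adicCompletion K)) (n := n)
      (by exact_mod_cast hn)
  -- lower bound: `n² = #E[n]^{Γ_{K_v}} ∣ #E(K_v)[n]`
  have hdvd := W.card_fixed_dvd_card_torsionPoints v n ι
  rw [Nat.card_congr (Equiv.subtypeUnivEquiv fun P => fun σ => hfix σ P), hgeom] at hdvd
  -- upper bound: `E(K_v)[n] ↪ E(K̄_v)[n]`
  haveI : Finite (W.torsionPoints (AlgebraicClosure (v.adicCompletion K)) n) :=
    Nat.finite_of_card_ne_zero (by rw [hloc]; exact pow_ne_zero 2 hn)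
  set j : (W.baseChange (v.adicCompletion K)).toAffine.Point →+
      (W.baseChange (AlgebraicClosure (v.adicCompletion K))).toAffine.Point :=
    Affine.Point.map (IsScalarTower.toAlgHom K (v.adicCompletion K)
      (AlgebraicClosure (v.adicCompletion K))) with hj
  have hjinj : Function.Injective j := by rw [hj]; exact Affine.Point.map_injective _
  have hjmem : ∀ P : W.torsionPoints (v.adicCompletion K) n,
      j P ∈ W.torsionPoints (AlgebraicClosure (v.adicCompletion K)) n := fun P => by
    refine (Submodule.mem_torsionBy_iff _ _).mpr ?_
    have hP : (n : ℤ) • (P : (W.baseChange (v.adicCompletion K)).toAffine.Point) = 0 :=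
      (Submodule.mem_torsionBy_iff _ _).mp P.2
    rw [← map_zsmul, hP, map_zero]
  have hfinj : Function.Injective fun P : W.torsionPoints (v.adicCompletion K) n =>
      (⟨j P, hjmem P⟩ : W.torsionPoints (AlgebraicClosure (v.adicCompletion K)) n) :=
    fun P Q h => Subtype.ext (hjinj (by simpa using congrArg Subtype.val h))
  haveI : Finite (W.torsionPoints (v.adicCompletion K) n) := Finite.of_injective _ hfinj
  have hle : Nat.card (W.torsionPoints (v.adicCompletion K) n) ≤ n ^ 2 := by
    rw [← hloc]; exact Nat.card_le_card_of_injective _ hfinj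
  exact le_antisymm hle (Nat.le_of_dvd Nat.card_pos hdvd)

/-- The same count for the kernel of multiplication by `n : ℕ` on `E(K_v)`:
`#ker(n : E(K_v) → E(K_v)) = n²` when `Γ_{K_v}` fixes `E[n]` — the currency of
`WeierstrassCurve.natCard_ker_map_sub_smul_quotient_adicCompletion_eq`.
[cite: McCallumLMS1991, §4 (p. 300)] [cite: SilvermanAEC2009, Cor. III.6.4(b) and VIII.§1] -/
theorem natCard_ker_nsmul_adicCompletion_eq_sq_of_forall_smul_eq
    (v : HeightOneSpectrum (𝓞 K)) {n : ℕ} (hn : n ≠ 0)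
    (ι : AlgebraicClosure K →ₐ[K] AlgebraicClosure (v.adicCompletion K))
    (hfix : ∀ (σ : absoluteGaloisGroup (v.adicCompletion K)) (P : W.geomTorsion n),
      resGalOfEmb ι σ • P = P) :
    Nat.card (nsmulAddMonoidHom n : (W.baseChange (v.adicCompletion K)).toAffine.Point →+
      (W.baseChange (v.adicCompletion K)).toAffine.Point).ker = n ^ 2 := by
  rw [← W.natCard_torsionPoints_adicCompletion_eq_sq_of_forall_smul_eq v hn ι hfix]
  refine Nat.card_congr (Equiv.subtypeEquivRight fun P => ?_)
  rw [AddMonoidHom.mem_ker, nsmulAddMonoidHom_apply]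
  change _ ↔ P ∈ AddSubgroup.torsionBy _ (n : ℤ)
  rw [AddSubgroup.torsionBy, Submodule.mem_toAddSubgroup, Submodule.mem_torsionBy_iff, natCast_zsmul]

end WeierstrassCurve

end
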